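import Summits.Schanuel.Schanuel.Theorems.ZilberEacParamRamifiedWitness
import HarnessLib

/-!
# Polynomially parametrised base curves, LXXX: the CONSTANT-FIBRE WITNESS — all labels, in any of
# the `2d` directions at infinity, over a polynomial curve `t ↦ (g₀(t), g₁(t))`

HONEST FRAMING.  Cell `pub-schanuel` (Zilber's Exponential-Algebraic Closedness, case ladder;
host summit Schanuel), seat 2, gen 27.  File LXXIX decided Mantova–Masser's density question over
polynomial curves with `2 ≤ deg g₀ < deg g₁` up to the CONSTANT-FIBRE cylinders
`W = {(g₀(t), g₁(t))} × {y₀ = θ} × ℂ`, on which the transcendence method is silent (the cycle at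
infinity is `t = 1/s`, `y₀ ≡ θ`, whose logarithm `log(ψ/θ) ≡ 0` is trivially algebraic).  Their
exponential points are ALL explicit: `g₀(t) ∈ τ + 2πiℤ` (`θ = e^τ`), `y₁ = e^{g₁(t)}`.  With the chart
of file LXXIV for `ψ ≡ θ`, `k = 1` (`2πi·m(s)^{-d} = g₀(1/s) - τ`, `d = deg g₀`),
**`exists_constFibre_witness`** inverts `m` at `μ_j = ζ·(m₀ + j)^{-1/d}` for any direction `ζ` with
`ζ^d = σ = ±1` and produces, for EVERY large label, parameters `t_j` with
`g₀(t_j) = τ + 2πiσ(m₀ + j)` (so `e^{g₀(t_j)} = θ` exactly), `‖g₀(t_j)‖ → ∞`, the polar form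
`g₀(t_j) = (2πi + τμ_j^d)·μ_j^{-d}`, and the exact splitting `g₁(t_j) = Π(μ_j⁻¹) + r(μ_j)` with
`Π ∈ ℂ[X]` of degree `deg g₁` (the Laurent part of `g₁` along `t = Ut(μ)/μ`) and `r` analytic at `0`
— here `μ_j⁻¹ = ζ⁻¹ (m₀ + j)^{1/d}`, so the phases are PUISEUX phases `Π(ζ̄ u)`, `u = (m₀+j)^{1/d}`;
files LXXXI–LXXXII reduce them to polynomial phases by a growth argument in two directions.
Also exported: `r(m(s)) = g₁(1/s) - Π(1/m(s))` for small `s ≠ 0` (for the transport).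
[folklore analysis]; nothing here is specific to Schanuel's conjecture (neither used nor implied);
Mantova–Masser's question (PLMS 2024 §1 p. 5) and EC(3,2) stay OPEN.
-/

noncomputable section

open Filter Topology Polynomial Complex

set_option linter.dupNamespace false

namespace Summit.Schanuel.Schanuel.Theorems

/-- **The constant-fibre witness in direction `ζ` (all labels).**  See the module docstring.
[folklore] (new in this form) -/
theorem exists_constFibre_witness (g₀ g₁ : ℂ[X]) (hd : 1 ≤ g₀.natDegree) {θ : ℂ}
    {τ : ℂ} (hτ : Complex.exp τ = θ)
    {m : ℂ → ℂ} (hman : AnalyticAt ℂ m 0) (hm0 : m 0 = 0) (hm' : deriv m 0 ≠ 0)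
    (hchart : ∀ᶠ s in 𝓝 (0 : ℂ), s ≠ 0 → m s ≠ 0 ∧
      (2 * Real.pi * I) * (m s ^ g₀.natDegree)⁻¹ = g₀.eval s⁻¹ - τ) :
    ∃ (r : ℂ → ℂ) (Pl : ℂ[X]) (m₀ : ℕ),
      AnalyticAt ℂ r 0 ∧ Pl.natDegree = g₁.natDegree ∧
      (∀ᶠ s in 𝓝[≠] (0 : ℂ), r (m s) = g₁.eval s⁻¹ - Pl.eval (m s)⁻¹) ∧
      0 < m₀ ∧
      ∀ (ζ : ℂ) (σ : ℤ), (σ = 1 ∨ σ = -1) → ζ ^ g₀.natDegree = σ → ∃ μ t : ℕ → ℂ,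
      (∀ j, μ j = ζ * ((((m₀ + j : ℕ) : ℝ) ^ ((g₀.natDegree : ℝ)⁻¹) : ℝ) : ℂ)⁻¹) ∧
      (∀ j, μ j ≠ 0) ∧ Tendsto μ atTop (𝓝 0) ∧
      (∀ j, g₀.eval (t j) = τ + (σ : ℂ) * ((m₀ + j : ℕ) : ℂ) * (2 * Real.pi * I)) ∧
      (∀ j, g₀.eval (t j) = ((2 * Real.pi * I) + τ * μ j ^ g₀.natDegree) * (μ j)⁻¹ ^ g₀.natDegree) ∧
      (∀ j, Complex.exp (g₀.eval (t j)) = θ) ∧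
      Tendsto (fun j => ‖g₀.eval (t j)‖) atTop atTop ∧
      (∀ j, g₁.eval (t j) = Pl.eval ((μ j)⁻¹) + r (μ j)) := by
  classical
  set d := g₀.natDegree with hdd
  have hd0 : d ≠ 0 := by omega
  have hdpos : (0 : ℝ) < (d : ℝ) := by exact_mod_cast Nat.pos_of_ne_zero hd0
  -- the analytic inverse `Sinv` of the chart `m`
  have hstrict : HasStrictDerivAt m (deriv m 0) 0 := hman.hasStrictDerivAt
  have hSan₀ : AnalyticAt ℂ (hstrict.localInverse m _ _ hm') (m 0) := hman.analyticAt_localInverse hm'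
  have hleft : ∀ᶠ s in 𝓝 (0 : ℂ), hstrict.localInverse m _ _ hm' (m s) = s :=
    hstrict.eventually_left_inverse hm'
  have hright₀ : ∀ᶠ μ in 𝓝 (m 0), m (hstrict.localInverse m _ _ hm' μ) = μ :=
    hstrict.eventually_right_inverse hm'
  have hSder₀ : HasStrictDerivAt (hstrict.localInverse m _ _ hm') (deriv m 0)⁻¹ (m 0) :=
    hstrict.to_localInverse hm'
  set Sinv : ℂ → ℂ := hstrict.localInverse m _ _ hm' with hSinv
  rw [hm0] at hSan₀ hright₀ hSder₀
  have hSan : AnalyticAt ℂ Sinv 0 := hSan₀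
  have hS0 : Sinv 0 = 0 := by
    have h := hleft.self_of_nhds
    rwa [hm0] at h
  have hSder : deriv Sinv 0 = (deriv m 0)⁻¹ := hSder₀.hasDerivAt.deriv
  -- `Sinv μ = μ · V μ`, `V` analytic with `V 0 ≠ 0`; `Ut = V⁻¹`
  set V : ℂ → ℂ := dslope Sinv 0 with hV
  have hVan : AnalyticAt ℂ V 0 := by
    obtain ⟨q, hq⟩ := hSan
    exact ⟨_, hq.has_fpower_series_dslope_fslope⟩
  have hV0 : V 0 ≠ 0 := by
    rw [hV, dslope_same, hSder]
    exact inv_ne_zero hm'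
  have hSV : ∀ μ, Sinv μ = μ * V μ := fun μ => by
    have h := eq_add_mul_dslope Sinv μ
    rwa [hS0, zero_add] at h
  set Ut : ℂ → ℂ := fun μ => (V μ)⁻¹ with hUt
  have hUtan : AnalyticAt ℂ Ut 0 := hVan.inv hV0
  have hUt0 : Ut 0 ≠ 0 := inv_ne_zero hV0
  have hSU : ∀ μ, V μ ≠ 0 → (Sinv μ)⁻¹ = Ut μ * μ⁻¹ ^ 1 := by
    intro μ hVμ
    simp only [hSV μ, hUt, pow_one, mul_inv, mul_comm]
  -- the Laurent split of `g₁` along `t = Ut(μ)/μ`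
  obtain ⟨Pl, r, hPldeg, hPlc, hran, hlaur⟩ := exists_laurentPart g₁ hUtan (k := 1) le_rfl
  have hPl : Pl.natDegree = g₁.natDegree := by
    by_cases hp : g₁ = 0
    · have h0 : Pl.natDegree ≤ 0 := by simpa [hp] using hPldeg
      rw [Nat.le_zero.1 h0, hp, Polynomial.natDegree_zero]
    · rw [one_mul] at hPldeg hPlc
      refine Polynomial.natDegree_eq_of_le_of_coeff_ne_zero hPldeg ?_
      rw [hPlc]
      exact mul_ne_zero (Polynomial.leadingCoeff_ne_zero.2 hp) (pow_ne_zero _ hUt0)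
  -- facts on small `μ`
  have hScont : Tendsto Sinv (𝓝 0) (𝓝 0) := by
    have h := hSan.continuousAt.tendsto
    rwa [hS0] at h
  have hVne : ∀ᶠ μ in 𝓝 (0 : ℂ), V μ ≠ 0 := hVan.continuousAt.eventually_ne hV0
  have hgood : ∀ᶠ μ in 𝓝 (0 : ℂ), μ ≠ 0 → Sinv μ ≠ 0 ∧ m (Sinv μ) = μ ∧
      (Sinv μ)⁻¹ = Ut μ * μ⁻¹ ^ 1 ∧
      (2 * Real.pi * I) * (μ ^ d)⁻¹ = g₀.eval (Sinv μ)⁻¹ - τ := by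
    filter_upwards [hright₀, hVne, hScont.eventually hchart] with μ hr hVμ hc hμ
    have hSμ : Sinv μ ≠ 0 := by rw [hSV μ]; exact mul_ne_zero hμ hVμ
    obtain ⟨-, hid⟩ := hc hSμ
    rw [hr] at hid
    exact ⟨hSμ, hr, hSU μ hVμ, hid⟩
  obtain ⟨δ, hδ, hball⟩ := Metric.eventually_nhds_iff.1 hgood
  -- the labels: `u_j = (m₀ + j)^{1/d}`, `μ_j = ζ / u_j`, with `u_0 > 1/δ`
  obtain ⟨m₀, hm₀⟩ := exists_nat_gt (max (δ⁻¹ ^ d) 1)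
  have hm₀pos : 0 < m₀ := Nat.cast_pos.1 (lt_of_le_of_lt (by positivity) hm₀)
  set u : ℕ → ℝ := fun j => ((m₀ + j : ℕ) : ℝ) ^ ((d : ℝ)⁻¹) with hu
  have hlabpos : ∀ j, (0 : ℝ) < ((m₀ + j : ℕ) : ℝ) := fun j => by
    exact_mod_cast Nat.add_pos_left hm₀pos j
  have hupos : ∀ j, 0 < u j := fun j => Real.rpow_pos_of_pos (hlabpos j) _
  have hud : ∀ j, u j ^ d = ((m₀ + j : ℕ) : ℝ) := fun j =>
    Real.rpow_inv_natCast_pow (hlabpos j).le hd0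
  have hu0 : δ⁻¹ < u 0 := by
    have h1 : δ⁻¹ ^ d < ((m₀ + 0 : ℕ) : ℝ) := by
      rw [Nat.add_zero]; exact lt_of_le_of_lt (le_max_left _ _) hm₀
    have h2 := Real.rpow_lt_rpow (by positivity) h1 (inv_pos.2 hdpos)
    rwa [Real.pow_rpow_inv_natCast (by positivity) hd0] at h2
  have humono : ∀ j, u 0 ≤ u j := fun j =>
    Real.rpow_le_rpow (Nat.cast_nonneg _) (by exact_mod_cast Nat.le_add_right m₀ j)
      (inv_nonneg.2 (Nat.cast_nonneg d))
  have hlab : Tendsto (fun j : ℕ => m₀ + j) atTop atTop :=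
    tendsto_atTop_mono (fun j => Nat.le_add_left j m₀) tendsto_id
  have hutop : Tendsto u atTop atTop :=
    (tendsto_rpow_atTop (inv_pos.2 hdpos)).comp
      (tendsto_natCast_atTop_atTop.comp hlab)
  -- the `ζ`-independent part
  have hmcont : Tendsto m (𝓝 0) (𝓝 0) := by
    have h := hman.continuousAt.tendsto
    rwa [hm0] at h
  have hside : ∀ᶠ s in 𝓝[≠] (0 : ℂ), r (m s) = g₁.eval s⁻¹ - Pl.eval (m s)⁻¹ := by
    have hev : ∀ᶠ s in 𝓝 (0 : ℂ), s ≠ 0 → r (m s) = g₁.eval s⁻¹ - Pl.eval (m s)⁻¹ := by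
      filter_upwards [hleft, hchart, hmcont.eventually hgood] with s hl hc hg hs
      obtain ⟨hms, -⟩ := hc hs
      obtain ⟨-, -, hSU', -⟩ := hg hms
      rw [hl] at hSU'
      have h := hlaur (m s) hms
      rw [← hSU'] at h
      linear_combination -h
    exact eventually_nhdsWithin_iff.2 hev
  refine ⟨r, Pl, m₀, hran, hPl, hside, hm₀pos, fun ζ σ hσ hζ => ?_⟩
  -- the direction `ζ`
  have hσ1 : (σ : ℂ) * (σ : ℂ) = 1 := by
    rcases hσ with rfl | rfl <;> push_cast <;> ring
  have hσne : (σ : ℂ) ≠ 0 := fun h => by rw [h, mul_zero] at hσ1; exact zero_ne_one hσ1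
  have hσnorm : ‖(σ : ℂ)‖ = 1 := by
    rcases hσ with rfl | rfl <;> simp
  have hζd : ζ ^ d = σ := hζ
  have hζ0 : ζ ≠ 0 := fun h => hσne (by rw [← hζd, h, zero_pow hd0])
  have hζnorm : ‖ζ‖ = 1 := by
    have h : ‖ζ‖ ^ d = 1 := by rw [← norm_pow, hζd, hσnorm]
    exact (pow_eq_one_iff_of_nonneg (norm_nonneg _) hd0).1 h
  set μ : ℕ → ℂ := fun j => ζ * ((u j : ℝ) : ℂ)⁻¹ with hμ
  have huC : ∀ j, ((u j : ℝ) : ℂ) ≠ 0 := fun j => by exact_mod_cast (hupos j).ne'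
  have hμne : ∀ j, μ j ≠ 0 := fun j => mul_ne_zero hζ0 (inv_ne_zero (huC j))
  have hμnorm' : ∀ j, ‖μ j‖ = (u j)⁻¹ := fun j => by
    rw [hμ]
    simp only [norm_mul, norm_inv, Complex.norm_real, Real.norm_eq_abs, abs_of_pos (hupos j), hζnorm,
      one_mul]
  have hμnorm : ∀ j, ‖μ j‖ < δ := by
    intro j
    rw [hμnorm' j]
    calc (u j)⁻¹ ≤ (u 0)⁻¹ := inv_anti₀ (hupos 0) (humono j)
      _ < δ := by rw [inv_lt_comm₀ (hupos 0) hδ]; exact hu0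
  have hμlim : Tendsto μ atTop (𝓝 0) := by
    rw [tendsto_zero_iff_norm_tendsto_zero]
    exact (tendsto_inv_atTop_zero.comp hutop).congr fun j => (hμnorm' j).symm
  -- `μ_j^d = σ / (m₀ + j)` and its inverse
  have hμd : ∀ j, (μ j ^ d)⁻¹ = (σ : ℂ) * ((m₀ + j : ℕ) : ℂ) := by
    intro j
    have hσinv : ((σ : ℂ))⁻¹ = σ := inv_eq_of_mul_eq_one_right hσ1
    have e1 : μ j ^ d = (σ : ℂ) * ((((m₀ + j : ℕ) : ℝ)) : ℂ)⁻¹ := by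
      simp only [hμ]
      rw [mul_pow, hζd, inv_pow, ← Complex.ofReal_pow, hud j]
    rw [e1, mul_inv, inv_inv, hσinv, Complex.ofReal_natCast]
  have hfacts : ∀ j, Sinv (μ j) ≠ 0 ∧ m (Sinv (μ j)) = μ j ∧
      (Sinv (μ j))⁻¹ = Ut (μ j) * (μ j)⁻¹ ^ 1 ∧
      (2 * Real.pi * I) * (μ j ^ d)⁻¹ = g₀.eval (Sinv (μ j))⁻¹ - τ := fun j =>
    hball (by rw [dist_zero_right]; exact hμnorm j) (hμne j)
  -- the parameters `t_j` and the points `x₀ = g₀(t_j)`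
  set t : ℕ → ℂ := fun j => (Sinv (μ j))⁻¹ with ht
  have hzform : ∀ j, g₀.eval (t j) = τ + (σ : ℂ) * ((m₀ + j : ℕ) : ℂ) * (2 * Real.pi * I) := by
    intro j
    obtain ⟨-, -, -, hid⟩ := hfacts j
    rw [ht]
    simp only
    rw [hμd j] at hid
    linear_combination -hid
  have hzpolar : ∀ j, g₀.eval (t j) = ((2 * Real.pi * I) + τ * μ j ^ d) * (μ j)⁻¹ ^ d := by
    intro j
    obtain ⟨-, -, -, hid⟩ := hfacts j
    have hμd0 : μ j ^ d ≠ 0 := pow_ne_zero _ (hμne j)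
    rw [ht]
    simp only
    calc g₀.eval (Sinv (μ j))⁻¹ = (2 * Real.pi * I) * (μ j ^ d)⁻¹ + τ := by linear_combination -hid
      _ = ((2 * Real.pi * I) + τ * μ j ^ d) * (μ j)⁻¹ ^ d := by
          rw [inv_pow, add_mul, mul_inv_cancel_right₀ hμd0]
  have hexpz : ∀ j, Complex.exp (g₀.eval (t j)) = θ := by
    intro j
    rw [hzform j, show τ + (σ : ℂ) * ((m₀ + j : ℕ) : ℂ) * (2 * Real.pi * I) =
      τ + ((σ * (m₀ + j : ℕ) : ℤ) : ℂ) * (2 * Real.pi * I) by push_cast; ring, Complex.exp_add, hτ,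
      Complex.exp_int_mul_two_pi_mul_I, mul_one]
  have hzlow : ∀ j, 6 * ((m₀ + j : ℕ) : ℝ) - ‖τ‖ ≤ ‖g₀.eval (t j)‖ := by
    intro j
    have h2π : (6 : ℝ) ≤ ‖(2 * Real.pi * I : ℂ)‖ := by
      rw [show (2 * Real.pi * I : ℂ) = ((2 * Real.pi : ℝ) : ℂ) * I by push_cast; ring, norm_mul,
        Complex.norm_I, mul_one, Complex.norm_real, Real.norm_eq_abs, abs_of_pos Real.two_pi_pos]
      have := Real.pi_gt_three
      linarith
    have hmain : ‖(σ : ℂ) * ((m₀ + j : ℕ) : ℂ) * (2 * Real.pi * I)‖ - ‖τ‖ ≤ ‖g₀.eval (t j)‖ := by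
      rw [hzform j, show τ + (σ : ℂ) * ((m₀ + j : ℕ) : ℂ) * (2 * Real.pi * I) =
        (σ : ℂ) * ((m₀ + j : ℕ) : ℂ) * (2 * Real.pi * I) + τ by ring]
      exact norm_sub_le_norm_add _ _
    rw [norm_mul, norm_mul, hσnorm, one_mul, Complex.norm_natCast] at hmain
    have hK0 : (0 : ℝ) ≤ ((m₀ + j : ℕ) : ℝ) := Nat.cast_nonneg _
    nlinarith
  have hznorm : Tendsto (fun j => ‖g₀.eval (t j)‖) atTop atTop := by
    refine Literature.ModelTheory.Zilber.tendsto_norm_atTop_of_le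
      (K := fun j => ((m₀ + j : ℕ) : ℝ)) ?_ (a := 6) (b := ‖τ‖) (by norm_num) hzlow
    exact tendsto_natCast_atTop_atTop.comp hlab
  refine ⟨μ, t, fun j => ?_, hμne, hμlim, hzform, hzpolar, hexpz, hznorm, fun j => ?_⟩
  · rfl
  · obtain ⟨-, -, hSU', -⟩ := hfacts j
    have h := hlaur (μ j) (hμne j)
    rw [ht]
    simp only
    rw [hSU', h]

end Summit.Schanuel.Schanuel.Theorems
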